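import Summits.BirchSwinnertonDyer.BirchSwinnertonDyer.Theorems.Rank2ObservatoryIsoGroup0
import Summits.BirchSwinnertonDyer.BirchSwinnertonDyer.Theorems.Rank2ObservatoryIsoGroup1
import Summits.BirchSwinnertonDyer.BirchSwinnertonDyer.Theorems.Rank2ObservatoryIsoGroup2
import Summits.BirchSwinnertonDyer.BirchSwinnertonDyer.Theorems.Rank2ObservatoryIsoGroup3
import Summits.BirchSwinnertonDyer.BirchSwinnertonDyer.Theorems.Rank2ObservatoryIsoGroup4
import Summits.BirchSwinnertonDyer.BirchSwinnertonDyer.Theorems.Rank2ObservatoryIsoGroup5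
import Summits.BirchSwinnertonDyer.BirchSwinnertonDyer.Theorems.Rank2ObservatoryIsoGroup6
import Summits.BirchSwinnertonDyer.BirchSwinnertonDyer.Theorems.Rank2ObservatoryIsoGroup7
import Summits.BirchSwinnertonDyer.BirchSwinnertonDyer.Theorems.Rank2ObservatoryIsoGroup8
import Summits.BirchSwinnertonDyer.BirchSwinnertonDyer.Theorems.Rank2ObservatoryIsoGroup9

/-!
# BirchSwinnertonDyer — rank ≥ 2 observatory: KERNEL-ISO CENSUS — 102416 rank-2 census curves with a rational `2`-torsion point have CERTIFIED Mordell–Weil rank `2`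

HONEST FRAMING: per-curve certified theorems and census instruments; no claim on BSD in rank ≥ 2.

Assembly level 2 of the KERNEL-ISO table: `isoTable` = the concatenation of the 10 chunk groups = all 411 DATA chunks
`Rank2ObservatoryIsoRowsNNN.lean` (102416 rows = 102416 of the 102 461 curves of the rank-2 census `rank2Table`
(`Rank2ObservatoryRank2Census.lean`) whose torsion subgroup is `ℤ/2`, namely ALL those with sharp `2`-isogeny Selmer
bound `#S^(φ)·#S^(φ̂) = 16`; the 45 others have `#S^(φ)·#S^(φ̂) = 64 > 2^(rank+2)`, i.e. non-trivial Ш(E)[φ] or Ш(E')[φ̂],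
outside the reach of this certificate; listed in `KERNEL-ISO.md`). THEOREMS: `isoTable_check`, `isoTable_census` (every row IS a
row of `rank2Table`, by the chunks' kernel JOIN theorems), `isoTable_census_rank`,
`isoTable_length : isoTable.length = 102416`, and
`isoTable_rank : ∀ R ∈ isoTable, R.curve.mordellWeilRank = 2` — for EVERY listed census model the Mordell–Weil rank is
exactly `2`, UNCONDITIONALLY (descent via `2`-isogeny with kernel-checked local insolubility certificates; no `L`-function,
no BSD, no GRH input). Each `R.curve` is literally the census model `⟨a₁,a₂,a₃,a₄,a₆⟩` of the row with label `R.label`.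

References: J. H. Silverman, J. Tate, *Rational Points on Elliptic Curves* (2nd ed. 2015), §3.6; J. E. Cremona, *Algorithms for
Modular Elliptic Curves* (2nd ed. 1997), §3.6 and tables.
-/

set_option linter.dupNamespace false

namespace Summit.BirchSwinnertonDyer.BirchSwinnertonDyer.Rank2Observatory.IsoLocal

/-- The KERNEL-ISO table: all 411 chunks, 102416 rows (labels `1088j1` … `499995g2`). [cite: CremonaAlgorithms1997, Tables] -/
noncomputable def isoTable : List IsoRow :=
  isoGroup0 ++ isoGroup1 ++ isoGroup2 ++ isoGroup3 ++ isoGroup4 ++ isoGroup5 ++ isoGroup6 ++ isoGroup7 ++ isoGroup8 ++ isoGroup9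

/-- Every row of the KERNEL-ISO table passes `IsoRow.check`. [cite: SilvermanTate2015, §3.6] -/
theorem isoTable_check : isoTable.all IsoRow.check = true := by
  simp only [isoTable, List.all_append, isoGroup0_check, isoGroup1_check, isoGroup2_check, isoGroup3_check, isoGroup4_check, isoGroup5_check, isoGroup6_check, isoGroup7_check, isoGroup8_check, isoGroup9_check, Bool.and_true]

/-- The KERNEL-ISO table has `102416` rows. [cite: CremonaAlgorithms1997, Tables] -/
theorem isoTable_length : isoTable.length = 102416 := by
  simp only [isoTable, List.length_append, isoGroup0_length, isoGroup1_length, isoGroup2_length, isoGroup3_length, isoGroup4_length, isoGroup5_length, isoGroup6_length, isoGroup7_length, isoGroup8_length, isoGroup9_length]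

/-- **KERNEL-ISO census theorem.** Every one of the `102416` listed rank-2 census models has Mordell–Weil rank exactly `2`,
unconditionally. [cite: SilvermanTate2015, §3.6] [cite: CremonaAlgorithms1997, §3.6 (Method 1)] -/
theorem isoTable_rank : ∀ R ∈ isoTable, R.curve.mordellWeilRank = 2 :=
  fun _ hR => IsoRow.mordellWeilRank_eq_two_of_all isoTable_check hR

/-- **KERNEL-ISO provenance theorem.** Every row of the KERNEL-ISO table is a row of the rank-2 census `rank2Table`
(`Rank2ObservatoryRank2Census.lean`): same Cremona label, same model (from the 411 kernel JOIN theorems).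
[cite: CremonaAlgorithms1997, Tables] -/
theorem isoTable_census : ∀ R ∈ isoTable, ∃ r ∈ rank2Table, censusKey r = R.key := by
  unfold isoTable
  exact List.forall_mem_append.2 ⟨List.forall_mem_append.2 ⟨List.forall_mem_append.2 ⟨List.forall_mem_append.2 ⟨List.forall_mem_append.2 ⟨List.forall_mem_append.2 ⟨List.forall_mem_append.2 ⟨List.forall_mem_append.2 ⟨List.forall_mem_append.2 ⟨isoGroup0_census, isoGroup1_census⟩, isoGroup2_census⟩, isoGroup3_census⟩, isoGroup4_census⟩, isoGroup5_census⟩, isoGroup6_census⟩, isoGroup7_census⟩, isoGroup8_census⟩, isoGroup9_census⟩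

/-- **KERNEL-ISO census theorem, census form.** Every row of the rank-2 census `rank2Table` whose (label, a-invariants)
key occurs in the KERNEL-ISO table — i.e. each of the 102416 rank-2 census curves with torsion `ℤ/2` and sharp `2`-isogeny
Selmer bound — has Mordell–Weil rank exactly `2`, unconditionally. [cite: SilvermanTate2015, §3.6]
[cite: CremonaAlgorithms1997, §3.6 (Method 1)] -/
theorem isoTable_census_rank : ∀ r ∈ rank2Table,
    censusKey r ∈ isoTable.map IsoRow.key → r.curve.mordellWeilRank = 2 :=
  fun _ _ h => census_rank_of_key_mem isoTable_check h

end Summit.BirchSwinnertonDyer.BirchSwinnertonDyer.Rank2Observatory.IsoLocal
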